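import Literature.Combinatorics.Optimization.LowDegreeFrobeniusSplit
import HarnessLib

/-!
# Lee–Raghavendra–Steurer 2015, Theorem 3.5 (degree reduction for the separating functional), PROVED

This file discharges the named fact `LeeRaghavendraSteurer2015_thm35` of
`SeparatingFunctionalPsdRank.lean` (LRS Thm 3.5 = Thm 3.2, arXiv:1411.6317 p. 16: for symmetric
`A(S)`, symmetric `B(x)` of degree `≤ ℓ`, a degree-`d` pseudo-density `D` and `τ ⪰ A(S)²`,
`E_{S,x} D(x_S)‖A(S)B(x)‖_F² ≥ −2‖D‖_∞ (ℓm/(n−m))^{d/4} √τ (E_{S,x}‖A(S)B(x)‖_F²)^{1/2} (E_x‖B(x)‖_F²)^{1/2}`)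
by FOLLOWING THE PRINTED PROOF (p. 16–17): "The proof consists of two steps that are captured by the
following two lemmas" — Lemma 3.6 (the Cauchy–Schwarz chain around the low/high split
`B = B_{S,low} + B_{S,hi}`) and Lemma 3.7 (the Fourier tail above a random `m`-subset).  Lemma 3.7 is
`LeeRaghavendraSteurer2015_lemma37_matrix` (`FourierTailRandomSubset.lean`); the matrix/Fourier
ingredients of Lemma 3.6 are in `LowDegreeFrobeniusSplit.lean` and `PseudoDensityRestrictedSquares.lean`.
Here:

* `Thm35.abs_frobSq_sub_frobSq_le` — the pointwise step "`|x² − y²| = |x+y|·|x−y|`" with the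
  triangle inequality `|‖AB‖_F − ‖AB_low‖_F| ≤ ‖AB_hi‖_F`;
* `Thm35.weighted_sum_lower_bound` — the scalar skeleton of Lemma 3.6: from the pointwise step,
  `|D| ≤ K`, `Σ‖AB_low‖² ≤ Σ‖AB‖²` and `Σ D(x_S)‖AB_low‖² ≥ 0`, Cauchy–Schwarz and Minkowski give
  `Σ D(x_S)‖AB‖² ≥ −2K (Σ‖AB_hi‖²)^{1/2} (Σ‖AB‖²)^{1/2}`;
* `LeeRaghavendraSteurer2015_thm35_of_nonneg` (the case `τ ≥ 0`) and
  `LeeRaghavendraSteurer2015_thm35_holds` — the assembly with Lemma 3.7 and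
  `‖A B_hi‖_F² ≤ τ‖B_hi‖_F²`, then division by `C(n,m)·2ⁿ` (`(ρ^{d/2})^{1/2} = ρ^{d/4}`).

Source: [LeeRaghavendraSteurer2015] held text `paper:arxiv-1411.6317`, Thm 3.5 and Lemmas 3.6–3.7 with
proofs (p. 16–17).  Theorems only (no definitions, no facts).
-/

open Finset Matrix
open scoped MatrixOrder

namespace Literature.Combinatorics.Optimization

namespace Thm35

/-- **"`|x² − y²| = |x+y|·|x−y|`" and "the triangle inequality `‖AB‖_F − ‖AB_low‖_F ≤ ‖AB_hi‖_F`":**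
for `X = Y + Z`, `|‖X‖_F² − ‖Y‖_F²| ≤ (‖X‖_F + ‖Y‖_F)·‖Z‖_F`.
[cite: LeeRaghavendraSteurer2015, Lemma 3.6 proof (p. 16)] -/
theorem abs_frobSq_sub_frobSq_le {p q : ℕ} (X Y Z : Matrix (Fin p) (Fin q) ℝ) (h : X = Y + Z) :
    |frobSq X - frobSq Y| ≤ (Real.sqrt (frobSq X) + Real.sqrt (frobSq Y)) * Real.sqrt (frobSq Z) := by
  have hX := frobSq_nonneg X
  have hY := frobSq_nonneg Y
  -- squared Frobenius norms as single sums over the entries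
  have e : ∀ W : Matrix (Fin p) (Fin q) ℝ, frobSq W = ∑ ij : Fin p × Fin q, W ij.1 ij.2 ^ 2 :=
    fun W => (Fintype.sum_prod_type' fun i j => W i j ^ 2).symm
  have hrt : |Real.sqrt (frobSq X) - Real.sqrt (frobSq Y)| ≤ Real.sqrt (frobSq Z) := by
    rw [e X, e Y, e Z]
    have h1 := abs_sqrt_sum_sq_sub_sqrt_sum_sq_le univ (fun ij : Fin p × Fin q => X ij.1 ij.2)
      (fun ij => Y ij.1 ij.2)
    have hZ : ∀ ij : Fin p × Fin q, X ij.1 ij.2 - Y ij.1 ij.2 = Z ij.1 ij.2 := by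
      intro ij; rw [h, Matrix.add_apply]; ring
    simp_rw [hZ] at h1
    exact h1
  have hfac : frobSq X - frobSq Y =
      (Real.sqrt (frobSq X) + Real.sqrt (frobSq Y)) *
        (Real.sqrt (frobSq X) - Real.sqrt (frobSq Y)) := by
    rw [← sq_sub_sq, Real.sq_sqrt hX, Real.sq_sqrt hY]
  rw [hfac, abs_mul,
    abs_of_nonneg (by positivity : 0 ≤ Real.sqrt (frobSq X) + Real.sqrt (frobSq Y))]
  exact mul_le_mul_of_nonneg_left hrt (by positivity)

/-- **The scalar skeleton of Lemma 3.6.**  If `|w_i| ≤ K`, `F_i, Lo_i, Hi_i ≥ 0`,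
`|F_i − Lo_i| ≤ (√F_i + √Lo_i)√Hi_i` pointwise, `Σ Lo ≤ Σ F` and `Σ w·Lo ≥ 0`, then
`Σ w·F ≥ −2K (Σ Hi)^{1/2} (Σ F)^{1/2}` ("In the second step, we applied Cauchy–Schwarz. The third
step used the triangle inequality"). [cite: LeeRaghavendraSteurer2015, Lemma 3.6 proof (p. 16)] -/
theorem weighted_sum_lower_bound {ι : Type*} (s : Finset ι) (w F Lo Hi : ι → ℝ) {K : ℝ}
    (hK : 0 ≤ K) (hw : ∀ i ∈ s, |w i| ≤ K) (hF : ∀ i ∈ s, 0 ≤ F i) (hLo : ∀ i ∈ s, 0 ≤ Lo i)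
    (hHi : ∀ i ∈ s, 0 ≤ Hi i)
    (hpt : ∀ i ∈ s, |F i - Lo i| ≤ (Real.sqrt (F i) + Real.sqrt (Lo i)) * Real.sqrt (Hi i))
    (hsplit : ∑ i ∈ s, Lo i ≤ ∑ i ∈ s, F i) (hpos : 0 ≤ ∑ i ∈ s, w i * Lo i) :
    -(2 * K * Real.sqrt (∑ i ∈ s, Hi i) * Real.sqrt (∑ i ∈ s, F i)) ≤ ∑ i ∈ s, w i * F i := by
  -- pointwise: `w (F − Lo) ≥ −K (√F + √Lo) √Hi`
  have h1 : ∀ i ∈ s, -(K * ((Real.sqrt (F i) + Real.sqrt (Lo i)) * Real.sqrt (Hi i))) ≤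
      w i * (F i - Lo i) := by
    intro i hi
    have : |w i * (F i - Lo i)| ≤ K * ((Real.sqrt (F i) + Real.sqrt (Lo i)) * Real.sqrt (Hi i)) := by
      rw [abs_mul]
      exact mul_le_mul (hw i hi) (hpt i hi) (abs_nonneg _) hK
    linarith [neg_abs_le (w i * (F i - Lo i))]
  have h2 : -(K * ∑ i ∈ s, (Real.sqrt (F i) + Real.sqrt (Lo i)) * Real.sqrt (Hi i)) ≤
      ∑ i ∈ s, w i * (F i - Lo i) := by
    rw [mul_sum, ← sum_neg_distrib]
    exact sum_le_sum h1
  -- Cauchy–Schwarz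
  have h3 : ∑ i ∈ s, (Real.sqrt (F i) + Real.sqrt (Lo i)) * Real.sqrt (Hi i) ≤
      Real.sqrt (∑ i ∈ s, (Real.sqrt (F i) + Real.sqrt (Lo i)) ^ 2) *
        Real.sqrt (∑ i ∈ s, Hi i) := by
    have h := Real.sum_mul_le_sqrt_mul_sqrt s (fun i => Real.sqrt (F i) + Real.sqrt (Lo i))
      (fun i => Real.sqrt (Hi i))
    have hHi' : ∑ i ∈ s, Real.sqrt (Hi i) ^ 2 = ∑ i ∈ s, Hi i :=
      sum_congr rfl fun i hi => Real.sq_sqrt (hHi i hi)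
    rw [hHi'] at h
    exact h
  -- Minkowski and `Σ Lo ≤ Σ F`
  have h4 : Real.sqrt (∑ i ∈ s, (Real.sqrt (F i) + Real.sqrt (Lo i)) ^ 2) ≤
      2 * Real.sqrt (∑ i ∈ s, F i) := by
    have h := sqrt_sum_add_sq_le s (fun i => Real.sqrt (F i)) (fun i => Real.sqrt (Lo i))
    have hF' : ∑ i ∈ s, Real.sqrt (F i) ^ 2 = ∑ i ∈ s, F i :=
      sum_congr rfl fun i hi => Real.sq_sqrt (hF i hi)
    have hLo' : ∑ i ∈ s, Real.sqrt (Lo i) ^ 2 = ∑ i ∈ s, Lo i :=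
      sum_congr rfl fun i hi => Real.sq_sqrt (hLo i hi)
    rw [hF', hLo'] at h
    have h5 : Real.sqrt (∑ i ∈ s, Lo i) ≤ Real.sqrt (∑ i ∈ s, F i) := Real.sqrt_le_sqrt hsplit
    linarith
  have hsum : ∑ i ∈ s, w i * F i = ∑ i ∈ s, w i * Lo i + ∑ i ∈ s, w i * (F i - Lo i) := by
    rw [← sum_add_distrib]
    exact sum_congr rfl fun i _ => by ring
  have hA : 0 ≤ Real.sqrt (∑ i ∈ s, Hi i) := Real.sqrt_nonneg _
  have h6 : ∑ i ∈ s, (Real.sqrt (F i) + Real.sqrt (Lo i)) * Real.sqrt (Hi i) ≤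
      2 * Real.sqrt (∑ i ∈ s, F i) * Real.sqrt (∑ i ∈ s, Hi i) :=
    h3.trans (mul_le_mul_of_nonneg_right h4 hA)
  have h7 := mul_le_mul_of_nonneg_left h6 hK
  rw [hsum]
  linarith

/-- `c·Id ⪯ c'·Id` for `c ≤ c'` (plumbing for the sign of `τ`). [cite: LeeRaghavendraSteurer2015, §2.1 (p. 10: Loewner ordering)] -/
theorem smul_one_le_smul_one {k : ℕ} {c c' : ℝ} (h : c ≤ c') :
    c • (1 : Matrix (Fin k) (Fin k) ℝ) ≤ c' • (1 : Matrix (Fin k) (Fin k) ℝ) := by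
  rw [Matrix.le_iff, ← sub_smul]
  exact PosSemidef.one.smul (sub_nonneg.2 h)

end Thm35

open Thm35 in
/-- **Lee–Raghavendra–Steurer 2015, Theorem 3.5, case `τ ≥ 0` (PROVED).**  The statement of
`LeeRaghavendraSteurer2015_thm35` under the extra hypothesis `0 ≤ τ` (automatic when `p ≥ 1`),
assembled from Lemma 3.6 (`LowDegreeFrobeniusSplit.lean`, `PseudoDensityRestrictedSquares.lean`,
`Thm35.weighted_sum_lower_bound`) and Lemma 3.7 (`LeeRaghavendraSteurer2015_lemma37_matrix`).
[cite: LeeRaghavendraSteurer2015, Thm 3.5 (p. 16), proof p. 16–17] -/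
theorem LeeRaghavendraSteurer2015_thm35_of_nonneg (n m d ℓ p : ℕ) (hmn : m < n)
    (A : {S : Finset (Fin n) // S.card = m} → Matrix (Fin p) (Fin p) ℝ)
    (B : (Fin n → Bool) → Matrix (Fin p) (Fin p) ℝ) (hA : ∀ S, (A S).IsSymm)
    (hB : ∀ i j, HasDegreeLE ℓ fun x => B x i j) (D : (Fin m → Bool) → ℝ) (K : ℝ)
    (hD : IsPseudoDensity d D) (hDK : ∀ x, |D x| ≤ K) (τ : ℝ) (hτ0 : 0 ≤ τ)
    (hτ : ∀ S, A S * A S ≤ τ • (1 : Matrix (Fin p) (Fin p) ℝ)) :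
    -(2 * K * (((ℓ : ℝ) * m) / ((n : ℝ) - m)) ^ ((d : ℝ) / 4) * Real.sqrt τ *
        Real.sqrt (subsetCubeExpect n m fun S x => frobSq (A S * B x)) *
        Real.sqrt (cubeExpect fun x => frobSq (B x)))
      ≤ subsetCubeExpect n m fun S x => D (cubeRestrict S x) * frobSq (A S * B x) := by
  -- the low and high parts of `B` above `S` (opaque abbreviations)
  obtain ⟨L, hL⟩ : ∃ L : {S : Finset (Fin n) // S.card = m} → (Fin n → Bool) →
      Matrix (Fin p) (Fin p) ℝ,
      L = fun S x => Matrix.of fun i j => fourierLowPart S.1 d (fun y => B y i j) x := ⟨_, rfl⟩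
  obtain ⟨H, hH⟩ : ∃ H : {S : Finset (Fin n) // S.card = m} → (Fin n → Bool) →
      Matrix (Fin p) (Fin p) ℝ,
      H = fun S x => Matrix.of fun i j => fourierHighPart S.1 d (fun y => B y i j) x := ⟨_, rfl⟩
  have hAB : ∀ S x, A S * B x = A S * L S x + A S * H S x := by
    intro S x
    rw [hL, hH]
    exact (congrArg (A S * ·) (matrix_split S.1 d B x)).trans (Matrix.mul_add _ _ _)
  -- constants
  have hK0 : 0 ≤ K := (abs_nonneg _).trans (hDK fun _ => false)
  have hnm : (0 : ℝ) < (n : ℝ) - m := by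
    have : (m : ℝ) < n := by exact_mod_cast hmn
    linarith
  set ρ : ℝ := ((ℓ : ℝ) * m) / ((n : ℝ) - m) with hρ
  have hρ0 : 0 ≤ ρ := by rw [hρ]; positivity
  set W : ℝ := (Fintype.card {S : Finset (Fin n) // S.card = m} : ℝ) * 2 ^ n with hW
  have hW0 : 0 < W := by
    have hc : (Fintype.card {S : Finset (Fin n) // S.card = m} : ℝ) = n.choose m := by
      rw [Fintype.card_finset_len, Fintype.card_fin]
    have : (0 : ℝ) < n.choose m := by exact_mod_cast Nat.choose_pos hmn.le
    rw [hW, hc]; positivity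
  -- Lemma 3.6, scalar skeleton, on the index set `S × x`
  have main := weighted_sum_lower_bound (univ : Finset ({S : Finset (Fin n) // S.card = m} ×
      (Fin n → Bool)))
    (fun i => D (cubeRestrict i.1 i.2)) (fun i => frobSq (A i.1 * B i.2))
    (fun i => frobSq (A i.1 * L i.1 i.2)) (fun i => frobSq (A i.1 * H i.1 i.2)) hK0
    (fun i _ => hDK _) (fun i _ => frobSq_nonneg _) (fun i _ => frobSq_nonneg _)
    (fun i _ => frobSq_nonneg _)
    (fun i _ => abs_frobSq_sub_frobSq_le _ _ _ (hAB i.1 i.2))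
  -- conversions between `Σ_{(S,x)}` and `Σ_S Σ_x`
  have eF : ∑ i : {S : Finset (Fin n) // S.card = m} × (Fin n → Bool), frobSq (A i.1 * B i.2) =
      ∑ S, ∑ x, frobSq (A S * B x) := Fintype.sum_prod_type' fun S x => frobSq (A S * B x)
  have eLo : ∑ i : {S : Finset (Fin n) // S.card = m} × (Fin n → Bool), frobSq (A i.1 * L i.1 i.2) =
      ∑ S, ∑ x, frobSq (A S * L S x) := Fintype.sum_prod_type' fun S x => frobSq (A S * L S x)
  have eHi : ∑ i : {S : Finset (Fin n) // S.card = m} × (Fin n → Bool), frobSq (A i.1 * H i.1 i.2) =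
      ∑ S, ∑ x, frobSq (A S * H S x) := Fintype.sum_prod_type' fun S x => frobSq (A S * H S x)
  have eDF : ∑ i : {S : Finset (Fin n) // S.card = m} × (Fin n → Bool),
      D (cubeRestrict i.1 i.2) * frobSq (A i.1 * B i.2) =
      ∑ S, ∑ x, D (cubeRestrict S x) * frobSq (A S * B x) :=
    Fintype.sum_prod_type' fun S x => D (cubeRestrict S x) * frobSq (A S * B x)
  have eDLo : ∑ i : {S : Finset (Fin n) // S.card = m} × (Fin n → Bool),
      D (cubeRestrict i.1 i.2) * frobSq (A i.1 * L i.1 i.2) =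
      ∑ S, ∑ x, D (cubeRestrict S x) * frobSq (A S * L S x) :=
    Fintype.sum_prod_type' fun S x => D (cubeRestrict S x) * frobSq (A S * L S x)
  -- "`E‖A B_low‖_F² + E‖A B_hi‖_F² = E‖AB‖_F²`" for every `S`
  have hsplitS : ∀ S, ∑ x, frobSq (A S * B x) =
      ∑ x, frobSq (A S * L S x) + ∑ x, frobSq (A S * H S x) := by
    intro S
    rw [hL, hH]
    exact sum_frobSq_mul_split S.1 d (A S) B
  have hsplit : ∑ i : {S : Finset (Fin n) // S.card = m} × (Fin n → Bool),
      frobSq (A i.1 * L i.1 i.2) ≤ ∑ i : {S : Finset (Fin n) // S.card = m} × (Fin n → Bool),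
      frobSq (A i.1 * B i.2) := by
    rw [eF, eLo]
    refine sum_le_sum fun S _ => ?_
    rw [hsplitS S]
    have : 0 ≤ ∑ x, frobSq (A S * H S x) := sum_nonneg fun _ _ => frobSq_nonneg _
    linarith
  -- "the expectation `E D(x_S)‖A B_low‖_F²` is non-negative"
  have hpos : 0 ≤ ∑ i : {S : Finset (Fin n) // S.card = m} × (Fin n → Bool),
      D (cubeRestrict i.1 i.2) * frobSq (A i.1 * L i.1 i.2) := by
    rw [eDLo]
    refine sum_nonneg fun S _ => ?_
    rw [hL]
    exact hD.sum_cubeRestrict_mul_frobSq_low_nonneg S (A S) B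
  have main' := main hsplit hpos
  rw [eF, eHi, eDF] at main'
  -- "`‖A B_hi‖_F² ≤ max_S ‖A(S)²‖ · ‖B_hi‖_F²`" and Lemma 3.7
  have hHi : ∑ S, ∑ x, frobSq (A S * H S x) ≤ τ * (W * (ρ ^ ((d : ℝ) / 2) *
      cubeExpect fun x => frobSq (B x))) := by
    have h1 : ∑ S, ∑ x, frobSq (A S * H S x) ≤ τ * ∑ S, ∑ x, frobSq (H S x) := by
      rw [mul_sum]
      refine sum_le_sum fun S _ => ?_
      rw [mul_sum]
      exact sum_le_sum fun x _ => frobSq_mul_le_of_sq_le (hA S) (hτ S) (H S x)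
    have h37 := LeeRaghavendraSteurer2015_lemma37_matrix (d := d) hmn B hB
    have h2 : ∑ S, ∑ x, frobSq (H S x) = W * subsetCubeExpect n m (fun S x =>
        frobSq (Matrix.of fun i j => fourierHighPart S.1 d (fun y => B y i j) x)) := by
      rw [hH]
      unfold subsetCubeExpect
      rw [hW, mul_div_cancel₀ _ hW0.ne']
    rw [h2] at h1
    exact h1.trans (mul_le_mul_of_nonneg_left (mul_le_mul_of_nonneg_left h37 hW0.le) hτ0)
  -- square roots
  have hsq : Real.sqrt (∑ S, ∑ x, frobSq (A S * H S x)) ≤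
      Real.sqrt τ * Real.sqrt W * ρ ^ ((d : ℝ) / 4) *
        Real.sqrt (cubeExpect fun x => frobSq (B x)) := by
    have hρ4 : Real.sqrt (ρ ^ ((d : ℝ) / 2)) = ρ ^ ((d : ℝ) / 4) := by
      rw [Real.sqrt_eq_rpow, ← Real.rpow_mul hρ0]
      congr 1
      ring
    refine (Real.sqrt_le_sqrt hHi).trans (le_of_eq ?_)
    rw [Real.sqrt_mul hτ0, Real.sqrt_mul hW0.le, Real.sqrt_mul (Real.rpow_nonneg hρ0 _), hρ4]
    ring
  have hsF : 0 ≤ Real.sqrt (∑ S, ∑ x, frobSq (A S * B x)) := Real.sqrt_nonneg _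
  have h8 := mul_le_mul_of_nonneg_right
    (mul_le_mul_of_nonneg_left hsq (by positivity : (0 : ℝ) ≤ 2 * K)) hsF
  -- divide by `W = C(n,m)·2ⁿ`
  have eW : Real.sqrt ((∑ S, ∑ x, frobSq (A S * B x)) / W) * W =
      Real.sqrt (∑ S, ∑ x, frobSq (A S * B x)) * Real.sqrt W := by
    rw [Real.sqrt_div' _ hW0.le, div_mul_eq_mul_div, mul_div_assoc, Real.div_sqrt]
  simp only [subsetCubeExpect]
  rw [← hW, le_div_iff₀ hW0]
  have e9 : -(2 * K * ρ ^ ((d : ℝ) / 4) * Real.sqrt τ *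
      Real.sqrt ((∑ S, ∑ x, frobSq (A S * B x)) / W) *
      Real.sqrt (cubeExpect fun x => frobSq (B x))) * W =
      -(2 * K * ρ ^ ((d : ℝ) / 4) * Real.sqrt τ * Real.sqrt (cubeExpect fun x => frobSq (B x))) *
        (Real.sqrt ((∑ S, ∑ x, frobSq (A S * B x)) / W) * W) := by ring
  rw [e9, eW]
  linarith

/-- **Lee–Raghavendra–Steurer 2015, Theorem 3.5 (degree reduction), PROVED:** the named fact
`LeeRaghavendraSteurer2015_thm35` holds.  (For `τ < 0` the hypothesis `A(S)² ⪯ τ Id` forces `p = 0`,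
where both sides vanish; formally we apply the case `τ' = 0 ⪰ τ` and use `√τ = 0 = √0`.)
[cite: LeeRaghavendraSteurer2015, Thm 3.5 (p. 16), proof p. 16–17] -/
theorem LeeRaghavendraSteurer2015_thm35_holds : LeeRaghavendraSteurer2015_thm35 := by
  intro n m d ℓ p _hn _hm hmn _hd _hdn _hℓ _hℓn A B hA _hBsymm hB D K hD hDK τ hτ
  by_cases hτ0 : 0 ≤ τ
  · exact LeeRaghavendraSteurer2015_thm35_of_nonneg n m d ℓ p hmn A B hA hB D K hD hDK τ hτ0 hτ
  · have hτ0' : τ ≤ 0 := (not_le.1 hτ0).le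
    have h := LeeRaghavendraSteurer2015_thm35_of_nonneg n m d ℓ p hmn A B hA hB D K hD hDK 0 le_rfl
      fun S => (hτ S).trans (Thm35.smul_one_le_smul_one hτ0')
    rw [Real.sqrt_zero] at h
    rw [Real.sqrt_eq_zero'.2 hτ0']
    exact h

end Literature.Combinatorics.Optimization
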